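import Mathlib
import HarnessLib
import Literature.MathematicalPhysics.StatisticalMechanics.RelevantProjectionBound
import Literature.MathematicalPhysics.StatisticalMechanics.DiscreteTaylorFields
import Literature.MathematicalPhysics.StatisticalMechanics.TaylorPolynomialNormsPullback

/-!
# The contraction estimate for `1 − Π₂` ([ABKM19] Lemma 8.9)

For a `C^{r₀}` functional `K` of the field, local for the gauge `T = T_k` of a box `S = a + [0,ρ']^d`
(`T = fieldGauge 𝔥 R p S`), the remainder `F = K − Π₂K(B)` (`Π₂` of `RelevantProjection`, centre
the box corner `a`, block `B ⊆ S`) has zero value, zero first derivative on polynomial test fields of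
degree `≤ ⌊d/2⌋+1` and zero second derivative on pairs of linear test fields at the zero field
(Lemma 8.5).  Measured in the NEXT-scale gauge `T' = fieldGauge 𝔥' R' p S` (`R' = LR`, `𝔥' ≤ κ𝔥`)
this gives the contraction **`tayNorm_Pi2Rem_le`**:
`|F|_{T'_0} ≤ (δ₁ + δ₂(2θ₁ + δ₂) + θ₁³)(1 + C_{8.7}) |K|_{T_0}` with `θ₁ = (𝔥'/𝔥)(R/R')` (gauge
comparison, orders `≥ 3`), `δ₁ = κ(dC₁+1)^{⌊d/2⌋+2}L^{-(⌊d/2⌋+2)}` (discrete Taylor approximation of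
order `⌊d/2⌋+1`, first order term), `δ₂ = κ(dC₁+1)²L^{-2}` (order-one Taylor approximation, second
order term).  With the [ABKM19] parameters (`κ = 2L^{-(d−2)/2}`, `θ₁ = 2L^{-d/2}`) every term is
`O(L^{-(d/2+⌊d/2⌋+1)})`: (8.55).

* `isGaugeLocal_eval`, `fieldGauge_const`, `exists_eq_single_of_mem_degIndex_one`;
* `Pi2Rem`, `contDiff_Pi2Rem`, `Pi2Rem_zero`;
* the cancellations `fderiv_Pi2Rem_taylorField` (order 1), `iteratedFDeriv_two_Pi2Rem_polyField`,
  `fderiv_fderiv_Pi2Rem_taylorField_one` (order 2);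
* the order-by-order bounds `norm_iteratedFDeriv_gaugeLift_Pi2Rem_le` (`s ≥ 1`, factor `θ₁^s`),
  `norm_iteratedFDeriv_one_gaugeLift_Pi2Rem_le`, `norm_iteratedFDeriv_two_gaugeLift_Pi2Rem_le`, and
  **`tayNorm_Pi2Rem_le`**.

Everything is proved; no named fact.

## References
* S. Adams, S. Buchholz, R. Kotecký, S. Müller, arXiv:1910.13564, Lemma 8.9 and its proof
  ((8.65)–(8.68)), Lemma 8.10 [AdamsBuchholzKoteckyMuller2019].
-/

noncomputable section

namespace Literature.MathematicalPhysics.StatisticalMechanics.GradientRG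

open Finset
open Literature.MathematicalPhysics.StatisticalMechanics.GradientFRD (iterDiff)

variable {𝕜 : Type*} [NormedField 𝕜] [NormedAlgebra ℝ 𝕜] {d M : ℕ} [NeZero M]

/-! ## Preliminaries -/

/-- `H(B,·)` is local for the field gauge of any `S ⊇ B` (`p ≥ ⌊d/2⌋+1`, `𝔥, R ≠ 0`).
[cite: AdamsBuchholzKoteckyMuller2019, Ch. 6.2 (M_0 ⊂ M(𝓑_k))] -/
theorem isGaugeLocal_eval {𝔥 R : ℝ} (h𝔥 : 𝔥 ≠ 0) (hR : R ≠ 0) {p : ℕ} (hp : d / 2 + 1 ≤ p)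
    {S B : Finset (Fin d → ZMod M)} (hBS : B ⊆ S) (H : RelevantHamiltonian 𝕜 d) :
    IsGaugeLocal (fieldGauge 𝔥 R p S) (fun φ : (Fin d → ZMod M) → ℝ => eval H B φ) := by
  intro φ ψ hT
  have hcomp : ∀ x ∈ B, ∀ α : Fin d → ℕ, 1 ≤ ∑ i, α i → ∑ i, α i ≤ p →
      iterDiff α φ x = iterDiff α ψ x := by
    intro x hx α h1 h2
    have h := congrFun hT ⟨⟨x, hBS hx⟩, ⟨α, mem_diffIndex.2 ⟨h1, h2⟩⟩⟩
    rw [fieldGauge_apply, fieldGauge_apply] at h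
    simp only at h
    have hc : 𝔥⁻¹ * R ^ (∑ i, α i) ≠ 0 := mul_ne_zero (inv_ne_zero h𝔥) (pow_ne_zero _ hR)
    exact mul_left_cancel₀ hc h
  show eval H B φ = eval H B ψ
  rw [eval_eq_taylor, eval_eq_taylor, evalLin_apply, evalLin_apply, evalQuad_apply, evalQuad_apply]
  congr 1
  · congr 1
    refine Finset.sum_congr rfl fun x hx => Finset.sum_congr rfl fun α _ => ?_
    obtain ⟨h1, h2⟩ := mem_linIndex.1 α.2
    rw [hcomp x hx α h1 (h2.trans hp)]
  · refine Finset.sum_congr rfl fun x hx => Finset.sum_congr rfl fun q _ => ?_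
    have hp1 : 1 ≤ p := le_trans (Nat.le_add_left 1 _) hp
    have h1 : ∀ i : Fin d, GradientFRD.fwdDiff i φ x = GradientFRD.fwdDiff i ψ x := fun i => by
      have := hcomp x hx (Pi.single i 1) (by simp) (by simpa using hp1)
      rwa [iterDiff_single, iterDiff_single] at this
    rw [h1, h1]

omit [NeZero M] in
/-- Constant fields have zero gauge. [cite: AdamsBuchholzKoteckyMuller2019, Ch. 6.4 (N_k contains the constants)] -/
theorem fieldGauge_const (𝔥 R : ℝ) (p : ℕ) (S : Finset (Fin d → ZMod M)) (c : ℝ) :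
    fieldGauge 𝔥 R p S (fun _ : Fin d → ZMod M => c) = 0 := by
  funext q
  rw [fieldGauge_apply, iterDiff_const_eq_zero (mem_diffIndex.1 q.2.2).1, Pi.zero_apply, mul_zero,
    Pi.zero_apply]

omit [NeZero M] in
/-- `b_0 = 1` as a function. [cite: AdamsBuchholzKoteckyMuller2019, Ch. 8.4 (8.35)] -/
theorem polyField_zero_index_eq (c : Fin d → ZMod M) : polyField c 0 = fun _ => (1 : ℝ) :=
  funext fun x => polyField_zero_index c x

/-- The nonzero multi-indices of degree `≤ 1` are the unit indices.
[cite: AdamsBuchholzKoteckyMuller2019, Lemma 8.10] -/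
theorem exists_eq_single_of_mem_degIndex_one {α : Fin d → ℕ} (hα : α ∈ degIndex d 1) (h0 : α ≠ 0) :
    ∃ i, α = Pi.single i 1 := by
  have hsum := mem_degIndex.1 hα
  obtain ⟨i, hi⟩ : ∃ i, α i ≠ 0 := by
    by_contra hcon; push Not at hcon; exact h0 (funext hcon)
  refine ⟨i, funext fun j => ?_⟩
  have hi1 : α i ≤ ∑ j, α j := Finset.single_le_sum (f := α) (fun j _ => Nat.zero_le _) (Finset.mem_univ i)
  by_cases hj : j = i
  · subst hj; simp; omega
  · rw [Pi.single_eq_of_ne hj]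
    have hsplit : α i + α j ≤ ∑ l, α l := by
      rw [← Finset.sum_pair (f := α) (Ne.symm hj)]
      exact Finset.sum_le_sum_of_subset_of_nonneg (Finset.subset_univ _) fun l _ _ => Nat.zero_le _
    omega

/-! ## The remainder `F = K − Π₂K(B)` -/

/-- `F = K − Π₂K(B)` (centre `a`, block `B`). [cite: AdamsBuchholzKoteckyMuller2019, Lemma 8.9] -/
def Pi2Rem (a : Fin d → ZMod M) (B : Finset (Fin d → ZMod M)) (K : ((Fin d → ZMod M) → ℝ) → 𝕜) :
    ((Fin d → ZMod M) → ℝ) → 𝕜 :=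
  K - fun φ => eval (Pi2 a B K) B φ

/-- `F` is as smooth as `K`. [cite: AdamsBuchholzKoteckyMuller2019, Lemma 8.9] -/
theorem contDiff_Pi2Rem {a : Fin d → ZMod M} {B : Finset (Fin d → ZMod M)}
    {K : ((Fin d → ZMod M) → ℝ) → 𝕜} {n : WithTop ℕ∞} (hK : ContDiff ℝ n K) :
    ContDiff ℝ n (Pi2Rem a B K) :=
  hK.sub (contDiff_eval _ _)

/-- `F` is local for any gauge for which `K` is and which sees `B`. [cite: AdamsBuchholzKoteckyMuller2019, Lemma 8.9] -/
theorem isGaugeLocal_Pi2Rem {𝔥 R : ℝ} (h𝔥 : 𝔥 ≠ 0) (hR : R ≠ 0) {p : ℕ} (hp : d / 2 + 1 ≤ p)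
    {S B : Finset (Fin d → ZMod M)} (hBS : B ⊆ S) {a : Fin d → ZMod M}
    {K : ((Fin d → ZMod M) → ℝ) → 𝕜} (hloc : IsGaugeLocal (fieldGauge 𝔥 R p S) K) :
    IsGaugeLocal (fieldGauge 𝔥 R p S) (Pi2Rem a B K) := fun φ ψ h => by
  simp only [Pi2Rem, Pi.sub_apply, hloc φ ψ h, isGaugeLocal_eval h𝔥 hR hp hBS (Pi2 a B K) φ ψ h]

/-- **`F(0) = 0`.** [cite: AdamsBuchholzKoteckyMuller2019, Lemma 8.5 (8.29)] -/
theorem Pi2Rem_zero {a : Fin d → ZMod M} {B : Finset (Fin d → ZMod M)} (hB : B.card ≠ 0)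
    (K : ((Fin d → ZMod M) → ℝ) → 𝕜) : Pi2Rem a B K 0 = 0 := by
  simp only [Pi2Rem, Pi.sub_apply, eval_Pi2_zero hB, sub_self]

/-! ## Duality: derivatives are controlled by the gauge of the directions -/

section Duality

variable {V : Type*} [NormedAddCommGroup V] [NormedSpace ℝ V] {T : ((Fin d → ZMod M) → ℝ) →ₗ[ℝ] V}
  {r₀ : ℕ} {G : ((Fin d → ZMod M) → ℝ) → 𝕜}

/-- `DG(0)(v)` in terms of the first Taylor coefficient norm: `‖DG(0)v‖ ≤ ‖D¹Ḡ(0)‖ ‖Tv‖`.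
[cite: AdamsBuchholzKoteckyMuller2019, Ch. 6.4 (6.45)–(6.46)] -/
theorem norm_fderiv_apply_le_gauge (hr₀ : 1 ≤ r₀) (hG : ContDiff ℝ r₀ G) (hloc : IsGaugeLocal T G)
    (v : (Fin d → ZMod M) → ℝ) :
    ‖fderiv ℝ G 0 v‖ ≤ ‖iteratedFDeriv ℝ 1 (gaugeLift T G) (T.rangeRestrict 0)‖ * ‖T v‖ := by
  have h := norm_iteratedFDeriv_apply_le hG hloc 0 hr₀ (fun _ : Fin 1 => v)
  rw [iteratedFDeriv_one_apply] at h
  simpa using h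

/-- `D²G(0)(u,v)`: `‖D²G(0)(u,v)‖ ≤ ‖D²Ḡ(0)‖ ‖Tu‖ ‖Tv‖`.
[cite: AdamsBuchholzKoteckyMuller2019, Ch. 6.4 (6.45)–(6.46)] -/
theorem norm_iteratedFDeriv_two_apply_le_gauge (hr₀ : 2 ≤ r₀) (hG : ContDiff ℝ r₀ G)
    (hloc : IsGaugeLocal T G) (u v : (Fin d → ZMod M) → ℝ) :
    ‖iteratedFDeriv ℝ 2 G 0 ![u, v]‖ ≤
      ‖iteratedFDeriv ℝ 2 (gaugeLift T G) (T.rangeRestrict 0)‖ * ‖T u‖ * ‖T v‖ := by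
  have h := norm_iteratedFDeriv_apply_le hG hloc 0 hr₀ ![u, v]
  rw [Fin.prod_univ_two] at h
  simpa [mul_assoc] using h

/-- A gauge-local functional has no first derivative in gauge-invisible directions.
[cite: AdamsBuchholzKoteckyMuller2019, Ch. 6.4 (remark after (6.46))] -/
theorem fderiv_apply_eq_zero_of_gauge (hr₀ : 1 ≤ r₀) (hG : ContDiff ℝ r₀ G) (hloc : IsGaugeLocal T G)
    {v : (Fin d → ZMod M) → ℝ} (hv : T v = 0) : fderiv ℝ G 0 v = 0 := by
  have h := norm_fderiv_apply_le_gauge hr₀ hG hloc v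
  rw [hv, norm_zero, mul_zero] at h
  exact norm_le_zero_iff.1 h

/-- A gauge-local functional has no second derivative with a gauge-invisible direction.
[cite: AdamsBuchholzKoteckyMuller2019, Ch. 6.4 (remark after (6.46))] -/
theorem iteratedFDeriv_two_apply_eq_zero_of_gauge (hr₀ : 2 ≤ r₀) (hG : ContDiff ℝ r₀ G)
    (hloc : IsGaugeLocal T G) {u v : (Fin d → ZMod M) → ℝ} (h : T u = 0 ∨ T v = 0) :
    iteratedFDeriv ℝ 2 G 0 ![u, v] = 0 := by
  have hb := norm_iteratedFDeriv_two_apply_le_gauge hr₀ hG hloc u v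
  rcases h with h | h <;> rw [h, norm_zero] at hb <;> simp only [mul_zero, zero_mul] at hb <;>
    exact norm_le_zero_iff.1 hb

end Duality

/-! ## The cancellations of Lemma 8.5 on Taylor fields -/

section Cancel

variable {a : Fin d → ZMod M} {B S : Finset (Fin d → ZMod M)} {p r₀ : ℕ} {𝔥 R : ℝ}
  {K : ((Fin d → ZMod M) → ℝ) → 𝕜}

/-- **Order one**: `DF(0)` vanishes on every discrete Taylor field of order `⌊d/2⌋+1` at `a`.
[cite: AdamsBuchholzKoteckyMuller2019, Lemma 8.9 ((8.67): ⟨(1−Π₂)K, P⟩_0 = 0 for P ∈ Π_1)] -/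
theorem fderiv_Pi2Rem_taylorField (hB : B.card ≠ 0) (hBS : B ⊆ S)
    (hroomB : ∀ x ∈ B, HasRoom a x (d / 2 + 1)) (h𝔥 : 0 < 𝔥) (hR : 0 < R) (hp : d / 2 + 1 ≤ p)
    (hr₀ : 1 ≤ r₀) (hK : ContDiff ℝ r₀ K) (hloc : IsGaugeLocal (fieldGauge 𝔥 R p S) K)
    (ξ : (Fin d → ZMod M) → ℝ) :
    fderiv ℝ (Pi2Rem a B K) 0 (taylorField a (d / 2 + 1) ξ) = 0 := by
  have hr₀' : (r₀ : WithTop ℕ∞) ≠ 0 := by exact_mod_cast (show r₀ ≠ 0 by omega)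
  have hKd : DifferentiableAt ℝ K 0 := hK.differentiable hr₀' 0
  have hEd : DifferentiableAt ℝ (fun φ : (Fin d → ZMod M) → ℝ => eval (Pi2 a B K) B φ) 0 :=
    (contDiff_eval _ _ (n := 1)).differentiable one_ne_zero 0
  unfold Pi2Rem
  rw [fderiv_sub hKd hEd]
  unfold taylorField
  rw [map_sum]
  refine Finset.sum_eq_zero fun α hα => ?_
  rw [map_smul, sub_apply]
  by_cases h0 : α = 0
  · subst h0
    rw [polyField_zero_index_eq,
      fderiv_apply_eq_zero_of_gauge hr₀ hK hloc (fieldGauge_const 𝔥 R p S 1),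
      fderiv_apply_eq_zero_of_gauge (le_refl 1) (contDiff_eval _ _)
        (isGaugeLocal_eval h𝔥.ne' hR.ne' hp hBS _) (fieldGauge_const 𝔥 R p S 1), sub_self, smul_zero]
  · have hαlin : α ∈ linIndex d := by
      rw [mem_linIndex]
      refine ⟨?_, mem_degIndex.1 hα⟩
      by_contra hcon
      apply h0; funext i
      have : α i ≤ ∑ j, α j := Finset.single_le_sum (f := α) (fun j _ => Nat.zero_le _) (Finset.mem_univ i)
      simp only [Pi.zero_apply]; omega
    have h85 := fderiv_eval_Pi2_polyField hB hroomB K ⟨α, hαlin⟩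
    simp only at h85
    rw [h85, sub_self, smul_zero]

/-- **Order two on the basis**: `D²F(0)(b_α, b_β) = 0` for `|α|, |β| ≤ 1`.
[cite: AdamsBuchholzKoteckyMuller2019, Lemma 8.9 ((8.68): ⟨(1−Π₂)K, P⟩_0 = 0 for P ∈ Π_2)] -/
theorem iteratedFDeriv_two_Pi2Rem_polyField (hB : B.card ≠ 0) (hBS : B ⊆ S)
    (hroomB : ∀ x ∈ B, HasRoom a x 1) (h𝔥 : 0 < 𝔥) (hR : 0 < R) (hp : d / 2 + 1 ≤ p)
    (hr₀ : 2 ≤ r₀) (hK : ContDiff ℝ r₀ K) (hloc : IsGaugeLocal (fieldGauge 𝔥 R p S) K)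
    {α β : Fin d → ℕ} (hα : α ∈ degIndex d 1) (hβ : β ∈ degIndex d 1) :
    iteratedFDeriv ℝ 2 (Pi2Rem a B K) 0 ![polyField a α, polyField a β] = 0 := by
  have hK2 : ContDiff ℝ 2 K := hK.of_le (by exact_mod_cast hr₀)
  have hlocE := isGaugeLocal_eval (𝕜 := 𝕜) h𝔥.ne' hR.ne' hp hBS (Pi2 a B K)
  unfold Pi2Rem
  rw [iteratedFDeriv_sub_apply hK2.contDiffAt (contDiff_eval _ _).contDiffAt, sub_apply]
  by_cases hα0 : α = 0
  · subst hα0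
    rw [polyField_zero_index_eq,
      iteratedFDeriv_two_apply_eq_zero_of_gauge hr₀ hK hloc (Or.inl (fieldGauge_const 𝔥 R p S 1)),
      iteratedFDeriv_two_apply_eq_zero_of_gauge (le_refl 2) (contDiff_eval _ _) hlocE
        (Or.inl (fieldGauge_const 𝔥 R p S 1)), sub_self]
  by_cases hβ0 : β = 0
  · subst hβ0
    rw [polyField_zero_index_eq,
      iteratedFDeriv_two_apply_eq_zero_of_gauge hr₀ hK hloc (Or.inr (fieldGauge_const 𝔥 R p S 1)),
      iteratedFDeriv_two_apply_eq_zero_of_gauge (le_refl 2) (contDiff_eval _ _) hlocE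
        (Or.inr (fieldGauge_const 𝔥 R p S 1)), sub_self]
  obtain ⟨i, rfl⟩ := exists_eq_single_of_mem_degIndex_one hα hα0
  obtain ⟨j, rfl⟩ := exists_eq_single_of_mem_degIndex_one hβ hβ0
  rw [iteratedFDeriv_two_eval_Pi2 hB hroomB hK2 i j, sub_self]

/-- **Order two on Taylor fields**: `D²F(0)(Tay_1ξ, Tay_1η) = 0`.
[cite: AdamsBuchholzKoteckyMuller2019, Lemma 8.9 (8.68)] -/
theorem fderiv_fderiv_Pi2Rem_taylorField_one (hB : B.card ≠ 0) (hBS : B ⊆ S)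
    (hroomB : ∀ x ∈ B, HasRoom a x 1) (h𝔥 : 0 < 𝔥) (hR : 0 < R) (hp : d / 2 + 1 ≤ p)
    (hr₀ : 2 ≤ r₀) (hK : ContDiff ℝ r₀ K) (hloc : IsGaugeLocal (fieldGauge 𝔥 R p S) K)
    (ξ η : (Fin d → ZMod M) → ℝ) :
    fderiv ℝ (fderiv ℝ (Pi2Rem a B K)) 0 (taylorField a 1 ξ) (taylorField a 1 η) = 0 := by
  unfold taylorField
  simp only [map_sum, map_smul, _root_.sum_apply, _root_.smul_apply]
  refine Finset.sum_eq_zero fun β hβ => smul_eq_zero_of_right _ ?_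
  refine Finset.sum_eq_zero fun α hα => smul_eq_zero_of_right _ ?_
  have h := iteratedFDeriv_two_Pi2Rem_polyField hB hBS hroomB h𝔥 hR hp hr₀ hK hloc hα hβ
  rw [iteratedFDeriv_two_apply] at h
  simpa using h

end Cancel

/-! ## Order-by-order bounds in the next-scale gauge -/

section Bounds

variable {a : Fin d → ZMod M} {B S : Finset (Fin d → ZMod M)} {p r₀ ρ' : ℕ} {𝔥 𝔥' R R' : ℝ}
  {K : ((Fin d → ZMod M) → ℝ) → 𝕜}

/-- The gauge of a lifted direction: `‖T'(σ' w)‖ = ‖w‖`. [cite: AdamsBuchholzKoteckyMuller2019, App. A.4] -/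
theorem norm_fieldGauge_gaugeSection (𝔥' R' : ℝ) (p : ℕ) (S : Finset (Fin d → ZMod M))
    (w : LinearMap.range (fieldGauge 𝔥' R' p S)) :
    ‖fieldGauge 𝔥' R' p S (gaugeSection (fieldGauge 𝔥' R' p S) w)‖ = ‖w‖ := by
  rw [apply_gaugeSection, Submodule.coe_norm]

/-- **All orders `s ≥ 1`**: `‖D^s F̄'(0)‖ ≤ (‖D^s K̄(0)‖ + ‖D^s Ē(0)‖) θ₁^s`, `θ₁ = (𝔥'/𝔥)(R/R')`
(gauge comparison of the lifted directions).
[cite: AdamsBuchholzKoteckyMuller2019, Lemma 8.9 (8.65)–(8.66)] -/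
theorem norm_iteratedFDeriv_gaugeLift_Pi2Rem_le (hBS : B ⊆ S) (h𝔥 : 0 < 𝔥) (h𝔥' : 0 < 𝔥') (hR : 0 < R)
    (hRR' : R ≤ R') (hp : d / 2 + 1 ≤ p) (hK : ContDiff ℝ r₀ K)
    (hloc : IsGaugeLocal (fieldGauge 𝔥 R p S) K) {s : ℕ} (hs : s ≤ r₀) :
    ‖iteratedFDeriv ℝ s (gaugeLift (fieldGauge 𝔥' R' p S) (Pi2Rem a B K))
        ((fieldGauge 𝔥' R' p S).rangeRestrict 0)‖ ≤
      (‖iteratedFDeriv ℝ s (gaugeLift (fieldGauge 𝔥 R p S) K) ((fieldGauge 𝔥 R p S).rangeRestrict 0)‖ +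
        ‖iteratedFDeriv ℝ s (gaugeLift (fieldGauge 𝔥 R p S)
          (fun φ : (Fin d → ZMod M) → ℝ => eval (Pi2 a B K) B φ)) ((fieldGauge 𝔥 R p S).rangeRestrict 0)‖) *
        (𝔥' / 𝔥 * (R / R')) ^ s := by
  set T := fieldGauge 𝔥 R p S with hT
  set T' := fieldGauge 𝔥' R' p S with hT'
  set E : ((Fin d → ZMod M) → ℝ) → 𝕜 := fun φ => eval (Pi2 a B K) B φ with hE
  set θ₁ : ℝ := 𝔥' / 𝔥 * (R / R') with hθ₁
  have hθ₁0 : 0 ≤ θ₁ := by have := hR.trans_le hRR'; positivity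
  have hs' : (s : WithTop ℕ∞) ≤ r₀ := by exact_mod_cast hs
  have hF : ContDiff ℝ r₀ (Pi2Rem a B K) := contDiff_Pi2Rem hK
  have hEcd : ContDiff ℝ r₀ E := contDiff_eval _ _
  have hlocE : IsGaugeLocal T E := isGaugeLocal_eval h𝔥.ne' hR.ne' hp hBS _
  have hcomp : gaugeLift T' (Pi2Rem a B K) = Pi2Rem a B K ∘ gaugeSectionCLM T' := rfl
  rw [hcomp, (gaugeSectionCLM T').iteratedFDeriv_comp_right hF _ hs', map_zero, map_zero]
  set NK := ‖iteratedFDeriv ℝ s (gaugeLift T K) (T.rangeRestrict 0)‖ with hNK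
  set NE := ‖iteratedFDeriv ℝ s (gaugeLift T E) (T.rangeRestrict 0)‖ with hNE
  refine ContinuousMultilinearMap.opNorm_le_bound (by positivity) fun w => ?_
  rw [ContinuousMultilinearMap.compContinuousLinearMap_apply]
  set ξ : Fin s → (Fin d → ZMod M) → ℝ := fun i => gaugeSectionCLM T' (w i) with hξ
  have hξn : ∀ i, ‖T' (ξ i)‖ = ‖w i‖ := fun i => norm_fieldGauge_gaugeSection 𝔥' R' p S (w i)
  have hTξ : ∀ i, ‖T (ξ i)‖ ≤ θ₁ * ‖w i‖ := fun i => by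
    rw [← hξn i]; exact norm_fieldGauge_le_mul h𝔥 h𝔥' hR hRR' p S (ξ i)
  have hsub : iteratedFDeriv ℝ s (Pi2Rem a B K) 0 = iteratedFDeriv ℝ s K 0 - iteratedFDeriv ℝ s E 0 := by
    unfold Pi2Rem
    exact iteratedFDeriv_sub_apply (hK.of_le hs').contDiffAt (hEcd.of_le hs').contDiffAt
  rw [hsub, sub_apply]
  have hprod : ∏ i, ‖T (ξ i)‖ ≤ θ₁ ^ s * ∏ i, ‖w i‖ := by
    calc ∏ i, ‖T (ξ i)‖ ≤ ∏ i, (θ₁ * ‖w i‖) :=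
          Finset.prod_le_prod (fun i _ => norm_nonneg _) fun i _ => hTξ i
      _ = θ₁ ^ s * ∏ i, ‖w i‖ := by
          rw [Finset.prod_mul_distrib, Finset.prod_const, Finset.card_univ, Fintype.card_fin]
  calc ‖iteratedFDeriv ℝ s K 0 ξ - iteratedFDeriv ℝ s E 0 ξ‖
      ≤ ‖iteratedFDeriv ℝ s K 0 ξ‖ + ‖iteratedFDeriv ℝ s E 0 ξ‖ := norm_sub_le _ _
    _ ≤ NK * ∏ i, ‖T (ξ i)‖ + NE * ∏ i, ‖T (ξ i)‖ :=
        add_le_add (norm_iteratedFDeriv_apply_le hK hloc 0 hs ξ) (norm_iteratedFDeriv_apply_le hEcd hlocE 0 hs ξ)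
    _ = (NK + NE) * ∏ i, ‖T (ξ i)‖ := by ring
    _ ≤ (NK + NE) * (θ₁ ^ s * ∏ i, ‖w i‖) := mul_le_mul_of_nonneg_left hprod (by positivity)
    _ = (NK + NE) * θ₁ ^ s * ∏ i, ‖w i‖ := by ring

/-- **Order one with the Taylor cancellation**: `‖D¹F̄'(0)‖ ≤ (‖D¹K̄(0)‖ + ‖D¹Ē(0)‖) δ₁`,
`δ₁ = κ(dC₁+1)^{⌊d/2⌋+2}L^{-(⌊d/2⌋+2)}`. [cite: AdamsBuchholzKoteckyMuller2019, Lemma 8.9 (8.67)] -/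
theorem norm_iteratedFDeriv_one_gaugeLift_Pi2Rem_le (hS : ∀ x, x ∈ S ↔ InBox a ρ' x)
    (ha : InBox a ρ' a) (hroom : ∀ x ∈ S, HasRoom a x p) (hp : d / 2 + 2 ≤ p) (hBS : B ⊆ S)
    (hB : B.card ≠ 0) {L κ C₁ : ℝ} (h𝔥 : 0 < 𝔥) (h𝔥' : 0 < 𝔥') (hR : 0 < R) (hL : 1 ≤ L)
    (hRR : R' = L * R) (hκ : 𝔥' ≤ κ * 𝔥) (hC₁ : 0 ≤ C₁) (hρ : (ρ' : ℝ) ≤ C₁ * R) (hr₀ : 1 ≤ r₀)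
    (hK : ContDiff ℝ r₀ K) (hloc : IsGaugeLocal (fieldGauge 𝔥 R p S) K) :
    ‖iteratedFDeriv ℝ 1 (gaugeLift (fieldGauge 𝔥' R' p S) (Pi2Rem a B K))
        ((fieldGauge 𝔥' R' p S).rangeRestrict 0)‖ ≤
      (‖iteratedFDeriv ℝ 1 (gaugeLift (fieldGauge 𝔥 R p S) K) ((fieldGauge 𝔥 R p S).rangeRestrict 0)‖ +
        ‖iteratedFDeriv ℝ 1 (gaugeLift (fieldGauge 𝔥 R p S)
          (fun φ : (Fin d → ZMod M) → ℝ => eval (Pi2 a B K) B φ)) ((fieldGauge 𝔥 R p S).rangeRestrict 0)‖) *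
        (κ * ((d : ℝ) * C₁ + 1) ^ (d / 2 + 2) / L ^ (d / 2 + 2)) := by
  set T := fieldGauge 𝔥 R p S with hT
  set T' := fieldGauge 𝔥' R' p S with hT'
  set E : ((Fin d → ZMod M) → ℝ) → 𝕜 := fun φ => eval (Pi2 a B K) B φ with hE
  set δ₁ : ℝ := κ * ((d : ℝ) * C₁ + 1) ^ (d / 2 + 2) / L ^ (d / 2 + 2) with hδ₁
  have hκ0 : 0 ≤ κ := by nlinarith
  have hδ₁0 : 0 ≤ δ₁ := by positivity
  have hr₀' : (1 : WithTop ℕ∞) ≤ r₀ := by exact_mod_cast hr₀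
  have hF : ContDiff ℝ r₀ (Pi2Rem a B K) := contDiff_Pi2Rem hK
  have hEcd : ContDiff ℝ r₀ E := contDiff_eval _ _
  have hp' : d / 2 + 1 ≤ p := by omega
  have hlocE : IsGaugeLocal T E := isGaugeLocal_eval h𝔥.ne' hR.ne' hp' hBS _
  have hroomB : ∀ x ∈ B, HasRoom a x (d / 2 + 1) := fun x hx => (hroom x (hBS hx)).mono hp'
  have hcomp : gaugeLift T' (Pi2Rem a B K) = Pi2Rem a B K ∘ gaugeSectionCLM T' := rfl
  rw [hcomp, (gaugeSectionCLM T').iteratedFDeriv_comp_right hF _ hr₀', map_zero, map_zero]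
  set NK := ‖iteratedFDeriv ℝ 1 (gaugeLift T K) (T.rangeRestrict 0)‖ with hNK
  set NE := ‖iteratedFDeriv ℝ 1 (gaugeLift T E) (T.rangeRestrict 0)‖ with hNE
  refine ContinuousMultilinearMap.opNorm_le_bound (by positivity) fun w => ?_
  rw [ContinuousMultilinearMap.compContinuousLinearMap_apply, iteratedFDeriv_one_apply]
  simp only [gaugeSectionCLM_apply]
  set ξ := gaugeSection T' (w 0) with hξ
  have hξn : ‖T' ξ‖ = ‖w 0‖ := norm_fieldGauge_gaugeSection 𝔥' R' p S (w 0)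
  set P := taylorField a (d / 2 + 1) ξ with hP
  -- the cancellation `DF(0)(P) = 0`
  have hcancel : fderiv ℝ (Pi2Rem a B K) 0 P = 0 :=
    fderiv_Pi2Rem_taylorField hB hBS hroomB h𝔥 hR hp' hr₀ hK hloc ξ
  have hsplit : fderiv ℝ (Pi2Rem a B K) 0 ξ = fderiv ℝ (Pi2Rem a B K) 0 (ξ - P) := by
    rw [map_sub, hcancel, sub_zero]
  -- differentiability
  have hr₀'' : (r₀ : WithTop ℕ∞) ≠ 0 := by exact_mod_cast (show r₀ ≠ 0 by omega)
  have hKd : DifferentiableAt ℝ K 0 := hK.differentiable hr₀'' 0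
  have hEd : DifferentiableAt ℝ E 0 := (contDiff_eval _ _ (n := 1)).differentiable one_ne_zero 0
  have hfsub : fderiv ℝ (Pi2Rem a B K) 0 (ξ - P) = fderiv ℝ K 0 (ξ - P) - fderiv ℝ E 0 (ξ - P) := by
    unfold Pi2Rem; rw [fderiv_sub hKd hEd, sub_apply]
  -- the Taylor approximation (Lemma 8.10 with `s = ⌊d/2⌋+1`)
  have htay : ‖T (ξ - P)‖ ≤ δ₁ * ‖T' ξ‖ :=
    norm_fieldGauge_sub_taylorField_le hS ha hroom (by omega) h𝔥 h𝔥' hR hL hRR hκ hC₁ hρ ξ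
  rw [hsplit, hfsub, Fin.prod_univ_one, ← hξn]
  calc ‖fderiv ℝ K 0 (ξ - P) - fderiv ℝ E 0 (ξ - P)‖
      ≤ ‖fderiv ℝ K 0 (ξ - P)‖ + ‖fderiv ℝ E 0 (ξ - P)‖ := norm_sub_le _ _
    _ ≤ NK * ‖T (ξ - P)‖ + NE * ‖T (ξ - P)‖ :=
        add_le_add (norm_fderiv_apply_le_gauge hr₀ hK hloc _) (norm_fderiv_apply_le_gauge hr₀ hEcd hlocE _)
    _ = (NK + NE) * ‖T (ξ - P)‖ := by ring
    _ ≤ (NK + NE) * (δ₁ * ‖T' ξ‖) := mul_le_mul_of_nonneg_left htay (by positivity)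
    _ = (NK + NE) * δ₁ * ‖T' ξ‖ := by ring

/-- **Order two with the Taylor cancellation**: `‖D²F̄'(0)‖ ≤ (‖D²K̄(0)‖ + ‖D²Ē(0)‖) δ₂(2θ₁ + δ₂)`,
`δ₂ = κ(dC₁+1)²L^{-2}`, `θ₁ = (𝔥'/𝔥)(R/R')`. [cite: AdamsBuchholzKoteckyMuller2019, Lemma 8.9 (8.68)] -/
theorem norm_iteratedFDeriv_two_gaugeLift_Pi2Rem_le (hS : ∀ x, x ∈ S ↔ InBox a ρ' x)
    (ha : InBox a ρ' a) (hroom : ∀ x ∈ S, HasRoom a x p) (hp : d / 2 + 2 ≤ p) (hBS : B ⊆ S)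
    (hB : B.card ≠ 0) {L κ C₁ : ℝ} (h𝔥 : 0 < 𝔥) (h𝔥' : 0 < 𝔥') (hR : 0 < R) (hL : 1 ≤ L)
    (hRR : R' = L * R) (hκ : 𝔥' ≤ κ * 𝔥) (hC₁ : 0 ≤ C₁) (hρ : (ρ' : ℝ) ≤ C₁ * R) (hr₀ : 2 ≤ r₀)
    (hK : ContDiff ℝ r₀ K) (hloc : IsGaugeLocal (fieldGauge 𝔥 R p S) K) :
    ‖iteratedFDeriv ℝ 2 (gaugeLift (fieldGauge 𝔥' R' p S) (Pi2Rem a B K))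
        ((fieldGauge 𝔥' R' p S).rangeRestrict 0)‖ ≤
      (‖iteratedFDeriv ℝ 2 (gaugeLift (fieldGauge 𝔥 R p S) K) ((fieldGauge 𝔥 R p S).rangeRestrict 0)‖ +
        ‖iteratedFDeriv ℝ 2 (gaugeLift (fieldGauge 𝔥 R p S)
          (fun φ : (Fin d → ZMod M) → ℝ => eval (Pi2 a B K) B φ)) ((fieldGauge 𝔥 R p S).rangeRestrict 0)‖) *
        (κ * ((d : ℝ) * C₁ + 1) ^ 2 / L ^ 2 * (2 * (𝔥' / 𝔥 * (R / R')) + κ * ((d : ℝ) * C₁ + 1) ^ 2 / L ^ 2)) := by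
  set T := fieldGauge 𝔥 R p S with hT
  set T' := fieldGauge 𝔥' R' p S with hT'
  set E : ((Fin d → ZMod M) → ℝ) → 𝕜 := fun φ => eval (Pi2 a B K) B φ with hE
  set δ₂ : ℝ := κ * ((d : ℝ) * C₁ + 1) ^ 2 / L ^ 2 with hδ₂
  set θ₁ : ℝ := 𝔥' / 𝔥 * (R / R') with hθ₁
  have hRR' : R ≤ R' := by rw [hRR]; nlinarith
  have hκ0 : 0 ≤ κ := by nlinarith
  have hδ₂0 : 0 ≤ δ₂ := by positivity
  have hθ₁0 : 0 ≤ θ₁ := by have := hR.trans_le hRR'; positivity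
  have hr₀' : (2 : WithTop ℕ∞) ≤ r₀ := by exact_mod_cast hr₀
  have hF : ContDiff ℝ r₀ (Pi2Rem a B K) := contDiff_Pi2Rem hK
  have hK2 : ContDiff ℝ 2 K := hK.of_le hr₀'
  have hEcd : ContDiff ℝ r₀ E := contDiff_eval _ _
  have hp' : d / 2 + 1 ≤ p := by omega
  have hlocE : IsGaugeLocal T E := isGaugeLocal_eval h𝔥.ne' hR.ne' hp' hBS _
  have hroomB : ∀ x ∈ B, HasRoom a x 1 := fun x hx => (hroom x (hBS hx)).mono (by omega)
  have hcomp : gaugeLift T' (Pi2Rem a B K) = Pi2Rem a B K ∘ gaugeSectionCLM T' := rfl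
  rw [hcomp, (gaugeSectionCLM T').iteratedFDeriv_comp_right hF _ hr₀', map_zero, map_zero]
  set NK := ‖iteratedFDeriv ℝ 2 (gaugeLift T K) (T.rangeRestrict 0)‖ with hNK
  set NE := ‖iteratedFDeriv ℝ 2 (gaugeLift T E) (T.rangeRestrict 0)‖ with hNE
  refine ContinuousMultilinearMap.opNorm_le_bound (by positivity) fun w => ?_
  rw [ContinuousMultilinearMap.compContinuousLinearMap_apply]
  set ξ := gaugeSection T' (w 0) with hξ
  set η := gaugeSection T' (w 1) with hη
  have hvec : (fun i : Fin 2 => gaugeSectionCLM T' (w i)) = ![ξ, η] := by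
    funext i; fin_cases i <;> rfl
  rw [hvec, iteratedFDeriv_two_apply]
  simp only [Matrix.cons_val_zero, Matrix.cons_val_one]
  have hξn : ‖T' ξ‖ = ‖w 0‖ := norm_fieldGauge_gaugeSection 𝔥' R' p S (w 0)
  have hηn : ‖T' η‖ = ‖w 1‖ := norm_fieldGauge_gaugeSection 𝔥' R' p S (w 1)
  set Pξ := taylorField a 1 ξ with hPξ
  set Pη := taylorField a 1 η with hPη
  set Ψ := fderiv ℝ (fderiv ℝ (Pi2Rem a B K)) 0 with hΨ
  -- the bilinear bound `‖Ψ u v‖ ≤ (NK + NE) ‖Tu‖ ‖Tv‖`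
  have hbil : ∀ u v : (Fin d → ZMod M) → ℝ, ‖Ψ u v‖ ≤ (NK + NE) * ‖T u‖ * ‖T v‖ := by
    intro u v
    have h2 : Ψ u v = iteratedFDeriv ℝ 2 (Pi2Rem a B K) 0 ![u, v] := by
      rw [iteratedFDeriv_two_apply]; rfl
    have hsub : iteratedFDeriv ℝ 2 (Pi2Rem a B K) 0 = iteratedFDeriv ℝ 2 K 0 - iteratedFDeriv ℝ 2 E 0 := by
      unfold Pi2Rem
      exact iteratedFDeriv_sub_apply hK2.contDiffAt (hEcd.of_le hr₀').contDiffAt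
    rw [h2, hsub, sub_apply]
    calc ‖iteratedFDeriv ℝ 2 K 0 ![u, v] - iteratedFDeriv ℝ 2 E 0 ![u, v]‖
        ≤ ‖iteratedFDeriv ℝ 2 K 0 ![u, v]‖ + ‖iteratedFDeriv ℝ 2 E 0 ![u, v]‖ := norm_sub_le _ _
      _ ≤ NK * ‖T u‖ * ‖T v‖ + NE * ‖T u‖ * ‖T v‖ :=
          add_le_add (norm_iteratedFDeriv_two_apply_le_gauge hr₀ hK hloc u v)
            (norm_iteratedFDeriv_two_apply_le_gauge hr₀ hEcd hlocE u v)
      _ = (NK + NE) * ‖T u‖ * ‖T v‖ := by ring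
  -- the cancellation and the decomposition
  have hzero : Ψ Pξ Pη = 0 := fderiv_fderiv_Pi2Rem_taylorField_one hB hBS hroomB h𝔥 hR hp' hr₀ hK hloc ξ η
  have hdec : Ψ ξ η = Ψ (ξ - Pξ) η + Ψ Pξ (η - Pη) := by
    have h1 : Ψ (ξ - Pξ) η = Ψ ξ η - Ψ Pξ η := by rw [map_sub, sub_apply]
    have h2 : Ψ Pξ (η - Pη) = Ψ Pξ η - Ψ Pξ Pη := by rw [map_sub]
    rw [h1, h2, hzero]; ring
  -- the gauge bounds
  have htayξ : ‖T (ξ - Pξ)‖ ≤ δ₂ * ‖T' ξ‖ := by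
    have := norm_fieldGauge_sub_taylorField_le (s := 1) hS ha hroom (by omega) h𝔥 h𝔥' hR hL hRR hκ hC₁ hρ ξ
    simpa [hδ₂] using this
  have htayη : ‖T (η - Pη)‖ ≤ δ₂ * ‖T' η‖ := by
    have := norm_fieldGauge_sub_taylorField_le (s := 1) hS ha hroom (by omega) h𝔥 h𝔥' hR hL hRR hκ hC₁ hρ η
    simpa [hδ₂] using this
  have hTη : ‖T η‖ ≤ θ₁ * ‖T' η‖ := norm_fieldGauge_le_mul h𝔥 h𝔥' hR hRR' p S η
  have hTξ : ‖T ξ‖ ≤ θ₁ * ‖T' ξ‖ := norm_fieldGauge_le_mul h𝔥 h𝔥' hR hRR' p S ξ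
  have hTP : ‖T Pξ‖ ≤ (θ₁ + δ₂) * ‖T' ξ‖ := by
    have : T Pξ = T ξ - T (ξ - Pξ) := by rw [map_sub, sub_sub_cancel]
    rw [this]
    calc ‖T ξ - T (ξ - Pξ)‖ ≤ ‖T ξ‖ + ‖T (ξ - Pξ)‖ := norm_sub_le _ _
      _ ≤ θ₁ * ‖T' ξ‖ + δ₂ * ‖T' ξ‖ := add_le_add hTξ htayξ
      _ = (θ₁ + δ₂) * ‖T' ξ‖ := by ring
  rw [hdec, Fin.prod_univ_two, ← hξn, ← hηn]
  have hNN : 0 ≤ NK + NE := by positivity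
  calc ‖Ψ (ξ - Pξ) η + Ψ Pξ (η - Pη)‖ ≤ ‖Ψ (ξ - Pξ) η‖ + ‖Ψ Pξ (η - Pη)‖ := norm_add_le _ _
    _ ≤ (NK + NE) * ‖T (ξ - Pξ)‖ * ‖T η‖ + (NK + NE) * ‖T Pξ‖ * ‖T (η - Pη)‖ :=
        add_le_add (hbil _ _) (hbil _ _)
    _ ≤ (NK + NE) * (δ₂ * ‖T' ξ‖) * (θ₁ * ‖T' η‖) +
        (NK + NE) * ((θ₁ + δ₂) * ‖T' ξ‖) * (δ₂ * ‖T' η‖) := by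
        gcongr
    _ = (NK + NE) * (δ₂ * (2 * θ₁ + δ₂)) * (‖T' ξ‖ * ‖T' η‖) := by ring

end Bounds

/-! ## Lemma 8.9 -/

section Main

variable {a : Fin d → ZMod M} {B S : Finset (Fin d → ZMod M)} {p r₀ ρ' : ℕ}
  {𝔥 𝔥' R R' L κ C₁ : ℝ} {K : ((Fin d → ZMod M) → ℝ) → 𝕜}

/-- The contraction factor `ε = δ₁ + δ₂(2θ₁ + δ₂) + θ₁³`.
[cite: AdamsBuchholzKoteckyMuller2019, Lemma 8.9 (the constant C L^{-(d/2+⌊d/2⌋+1)})] -/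
def pi2ContrFactor (d : ℕ) (𝔥 𝔥' R R' L κ C₁ : ℝ) : ℝ :=
  κ * ((d : ℝ) * C₁ + 1) ^ (d / 2 + 2) / L ^ (d / 2 + 2) +
    κ * ((d : ℝ) * C₁ + 1) ^ 2 / L ^ 2 * (2 * (𝔥' / 𝔥 * (R / R')) + κ * ((d : ℝ) * C₁ + 1) ^ 2 / L ^ 2) +
    (𝔥' / 𝔥 * (R / R')) ^ 3

/-- **Every order**: `‖D^s F̄'(0)‖ ≤ (‖D^s K̄(0)‖ + ‖D^s Ē(0)‖) ε` for `s ≤ r₀`.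
[cite: AdamsBuchholzKoteckyMuller2019, Lemma 8.9 (8.65)–(8.68)] -/
theorem norm_iteratedFDeriv_gaugeLift_Pi2Rem_le_factor (hS : ∀ x, x ∈ S ↔ InBox a ρ' x)
    (ha : InBox a ρ' a) (hroom : ∀ x ∈ S, HasRoom a x p) (hp : d / 2 + 2 ≤ p) (hBS : B ⊆ S)
    (hB : B.card ≠ 0) (h𝔥 : 0 < 𝔥) (h𝔥' : 0 < 𝔥') (hR : 0 < R) (hL : 1 ≤ L) (hRR : R' = L * R)
    (hκ : 𝔥' ≤ κ * 𝔥) (hC₁ : 0 ≤ C₁) (hρ : (ρ' : ℝ) ≤ C₁ * R) (hθ : 𝔥' / 𝔥 * (R / R') ≤ 1)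
    (hr₀ : 2 ≤ r₀) (hK : ContDiff ℝ r₀ K) (hloc : IsGaugeLocal (fieldGauge 𝔥 R p S) K) {s : ℕ}
    (hs : s ≤ r₀) :
    ‖iteratedFDeriv ℝ s (gaugeLift (fieldGauge 𝔥' R' p S) (Pi2Rem a B K))
        ((fieldGauge 𝔥' R' p S).rangeRestrict 0)‖ ≤
      (‖iteratedFDeriv ℝ s (gaugeLift (fieldGauge 𝔥 R p S) K) ((fieldGauge 𝔥 R p S).rangeRestrict 0)‖ +
        ‖iteratedFDeriv ℝ s (gaugeLift (fieldGauge 𝔥 R p S)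
          (fun φ : (Fin d → ZMod M) → ℝ => eval (Pi2 a B K) B φ)) ((fieldGauge 𝔥 R p S).rangeRestrict 0)‖) *
        pi2ContrFactor d 𝔥 𝔥' R R' L κ C₁ := by
  set θ₁ : ℝ := 𝔥' / 𝔥 * (R / R') with hθ₁
  set δ₁ : ℝ := κ * ((d : ℝ) * C₁ + 1) ^ (d / 2 + 2) / L ^ (d / 2 + 2) with hδ₁
  set δ₂ : ℝ := κ * ((d : ℝ) * C₁ + 1) ^ 2 / L ^ 2 with hδ₂
  have hε : pi2ContrFactor d 𝔥 𝔥' R R' L κ C₁ = δ₁ + δ₂ * (2 * θ₁ + δ₂) + θ₁ ^ 3 := rfl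
  have hRR' : R ≤ R' := by rw [hRR]; nlinarith
  have hκ0 : 0 ≤ κ := by nlinarith
  have hθ₁0 : 0 ≤ θ₁ := by have := hR.trans_le hRR'; positivity
  have hδ₁0 : 0 ≤ δ₁ := by positivity
  have hδ₂0 : 0 ≤ δ₂ := by positivity
  have hX0 : 0 ≤ δ₂ * (2 * θ₁ + δ₂) := by positivity
  have hθ30 : 0 ≤ θ₁ ^ 3 := by positivity
  have h1ε : δ₁ ≤ pi2ContrFactor d 𝔥 𝔥' R R' L κ C₁ := by rw [hε]; linarith
  have h2ε : δ₂ * (2 * θ₁ + δ₂) ≤ pi2ContrFactor d 𝔥 𝔥' R R' L κ C₁ := by rw [hε]; linarith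
  have h3ε : θ₁ ^ 3 ≤ pi2ContrFactor d 𝔥 𝔥' R R' L κ C₁ := by rw [hε]; linarith
  have hε0 : 0 ≤ pi2ContrFactor d 𝔥 𝔥' R R' L κ C₁ := by rw [hε]; positivity
  have hp' : d / 2 + 1 ≤ p := by omega
  have hN0 : 0 ≤ ‖iteratedFDeriv ℝ s (gaugeLift (fieldGauge 𝔥 R p S) K) ((fieldGauge 𝔥 R p S).rangeRestrict 0)‖ +
      ‖iteratedFDeriv ℝ s (gaugeLift (fieldGauge 𝔥 R p S)
        (fun φ : (Fin d → ZMod M) → ℝ => eval (Pi2 a B K) B φ)) ((fieldGauge 𝔥 R p S).rangeRestrict 0)‖ := by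
    positivity
  rcases Nat.lt_or_ge s 3 with hs3 | hs3
  · interval_cases s
    · -- order 0: `F(0) = 0`
      rw [norm_iteratedFDeriv_zero, map_zero, gaugeLift_apply, map_zero, Pi2Rem_zero hB, norm_zero]
      exact mul_nonneg hN0 hε0
    · exact (norm_iteratedFDeriv_one_gaugeLift_Pi2Rem_le hS ha hroom hp hBS hB h𝔥 h𝔥' hR hL hRR hκ hC₁
        hρ (by omega) hK hloc).trans (mul_le_mul_of_nonneg_left h1ε hN0)
    · exact (norm_iteratedFDeriv_two_gaugeLift_Pi2Rem_le hS ha hroom hp hBS hB h𝔥 h𝔥' hR hL hRR hκ hC₁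
        hρ hr₀ hK hloc).trans (mul_le_mul_of_nonneg_left h2ε hN0)
  · refine (norm_iteratedFDeriv_gaugeLift_Pi2Rem_le hBS h𝔥 h𝔥' hR hRR' hp' hK hloc hs).trans ?_
    refine mul_le_mul_of_nonneg_left ?_ hN0
    exact (pow_le_pow_of_le_one hθ₁0 hθ hs3).trans h3ε

/-- **[ABKM19] Lemma 8.9 (contraction of `1 − Π₂` under change of scale).**  For the box
`S = a + [0,ρ']^d` (room for `p ≥ ⌊d/2⌋+2` steps), a block `B ⊆ S`, gauges `T = fieldGauge 𝔥 R p S`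
(scale `k`) and `T' = fieldGauge 𝔥' R' p S` (scale `k+1`: `R' = LR`, `𝔥' ≤ κ𝔥`, `θ₁ = (𝔥'/𝔥)(R/R') ≤ 1`,
`ρ' ≤ C₁R`, `ρ' + ⌊d/2⌋+1 ≤ C₀R`) and a `T`-local `C^{r₀}` functional `K` (`r₀ ≥ 2`):
`|K − Π₂K(B)|_{T'_0} ≤ ε (1 + C_{8.7}(d,C₀)) |K|_{T_0}`, `ε = pi2ContrFactor` (`= δ₁ + δ₂(2θ₁+δ₂) + θ₁³`,
each term `O(L^{-(d/2+⌊d/2⌋+1)})` for the [ABKM19] parameters).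
[cite: AdamsBuchholzKoteckyMuller2019, Lemma 8.9] -/
theorem tayNorm_Pi2Rem_le (hS : ∀ x, x ∈ S ↔ InBox a ρ' x) (ha : InBox a ρ' a)
    (hroom : ∀ x ∈ S, HasRoom a x p) (hp : d / 2 + 2 ≤ p) (hBS : B ⊆ S) (hB : B.card ≠ 0)
    {C₀ : ℝ} (h𝔥 : 0 < 𝔥) (h𝔥' : 0 < 𝔥') (hR : 0 < R) (hL : 1 ≤ L) (hRR : R' = L * R)
    (hκ : 𝔥' ≤ κ * 𝔥) (hC₁ : 0 ≤ C₁) (hρ : (ρ' : ℝ) ≤ C₁ * R) (hC₀ : 1 ≤ C₀)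
    (hρ0 : (ρ' : ℝ) + (d / 2 + 1 : ℕ) ≤ C₀ * R) (hθ : 𝔥' / 𝔥 * (R / R') ≤ 1) (hr₀ : 2 ≤ r₀)
    (hK : ContDiff ℝ r₀ K) (hloc : IsGaugeLocal (fieldGauge 𝔥 R p S) K) :
    tayNorm (fieldGauge 𝔥' R' p S) r₀ (Pi2Rem a B K) 0 ≤
      pi2ContrFactor d 𝔥 𝔥' R R' L κ C₁ * (1 + pi2BoundConst d C₀) *
        tayNorm (fieldGauge 𝔥 R p S) r₀ K 0 := by
  set T := fieldGauge 𝔥 R p S with hT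
  set T' := fieldGauge 𝔥' R' p S with hT'
  set E : ((Fin d → ZMod M) → ℝ) → 𝕜 := fun φ => eval (Pi2 a B K) B φ with hE
  set ε := pi2ContrFactor d 𝔥 𝔥' R R' L κ C₁ with hεdef
  have hRR' : R ≤ R' := by rw [hRR]; nlinarith
  have hκ0 : 0 ≤ κ := by nlinarith
  have hε0 : 0 ≤ ε := by
    have hθ₁0 : 0 ≤ 𝔥' / 𝔥 * (R / R') := by have := hR.trans_le hRR'; positivity
    simp only [hεdef, pi2ContrFactor]; positivity
  have hp' : d / 2 + 1 ≤ p := by omega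
  -- termwise bound and summation
  have hsum : tayNorm T' r₀ (Pi2Rem a B K) 0 ≤ ε * (tayNorm T r₀ K 0 + tayNorm T r₀ E 0) := by
    unfold tayNorm
    rw [mul_add, Finset.mul_sum, Finset.mul_sum, ← Finset.sum_add_distrib]
    refine Finset.sum_le_sum fun s hs => ?_
    have hsr : s ≤ r₀ := Nat.lt_succ_iff.1 (Finset.mem_range.1 hs)
    have h := norm_iteratedFDeriv_gaugeLift_Pi2Rem_le_factor hS ha hroom hp hBS hB h𝔥 h𝔥' hR hL hRR hκ
      hC₁ hρ hθ hr₀ hK hloc hsr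
    have hfac : (0 : ℝ) ≤ (s.factorial : ℝ)⁻¹ := by positivity
    calc ((s.factorial : ℝ)⁻¹) * ‖iteratedFDeriv ℝ s (gaugeLift T' (Pi2Rem a B K)) (T'.rangeRestrict 0)‖
        ≤ ((s.factorial : ℝ)⁻¹) * ((‖iteratedFDeriv ℝ s (gaugeLift T K) (T.rangeRestrict 0)‖ +
            ‖iteratedFDeriv ℝ s (gaugeLift T E) (T.rangeRestrict 0)‖) * ε) :=
          mul_le_mul_of_nonneg_left h hfac
      _ = ε * (((s.factorial : ℝ)⁻¹) * ‖iteratedFDeriv ℝ s (gaugeLift T K) (T.rangeRestrict 0)‖) +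
          ε * (((s.factorial : ℝ)⁻¹) * ‖iteratedFDeriv ℝ s (gaugeLift T E) (T.rangeRestrict 0)‖) := by
          ring
  -- `|E|_{T_0} ≤ ‖Π₂K‖_{k,0} ≤ C_{8.7} |K|_{T_0}`
  have hSρ : ∀ x ∈ S, ∀ i, |relCoord a x i| ≤ ρ' := fun x hx i => by
    obtain ⟨h1, h2⟩ := (hS x).1 hx i
    rw [abs_of_nonneg h1]; exact h2
  have hEle : tayNorm T r₀ E 0 ≤ pi2BoundConst d C₀ * tayNorm T r₀ K 0 := by
    have h1 := tayNorm_eval_le (𝕜 := 𝕜) h𝔥 hR hp' hBS (Pi2 a B K) r₀ (0 : (Fin d → ZMod M) → ℝ)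
    rw [map_zero, norm_zero, add_zero, one_pow, one_mul] at h1
    exact h1.trans (hamNorm_Pi2_le hB hBS hroom hSρ h𝔥 hR hC₀ hρ0 hr₀ hK hloc)
  have ht0 : 0 ≤ tayNorm T r₀ K 0 := tayNorm_nonneg _ _ _ _
  calc tayNorm T' r₀ (Pi2Rem a B K) 0 ≤ ε * (tayNorm T r₀ K 0 + tayNorm T r₀ E 0) := hsum
    _ ≤ ε * (tayNorm T r₀ K 0 + pi2BoundConst d C₀ * tayNorm T r₀ K 0) :=
        mul_le_mul_of_nonneg_left (by linarith [hEle]) hε0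
    _ = ε * (1 + pi2BoundConst d C₀) * tayNorm T r₀ K 0 := by ring

end Main

end Literature.MathematicalPhysics.StatisticalMechanics.GradientRG

end
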